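import Summits.MatrixMultiplication.MatrixMultiplication.Theorems.OutsiderSandwichYield
import HarnessLib

/-!
# One spare: `⟨2⟩ ⊠ 𝔖₂(1) ⊵ ⟨2,2,2⟩ ⊕ ⟨1,1,2⟩` — the exact boundary of the spare ledger

Route `OutsiderSandwich` (decomposition cell `decomp-mm`, lens 4 «minimal counterexample /
extremal reduction», gen 28, addendum), support for the aside leaf `BlockOneIsMM`
(stmt-MatrixMultiplication-27147).  Requested by the critic (bus `CLEARED`/`ACK` l.1727) after the
census's orientation ledger I89a (l.1721, scratch `OneSpareX.lean`, census g24 — credited): two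
copies of the twisted star `𝔖 = 𝔖₂(1)` restrict to one `2 × 2` matrix product TOGETHER WITH one
spare matrix–vector pair `⟨1,1,2⟩` (the spare scalar on the star's MATRIX leg), as the
composition `[M] + [U] ≤ ([𝔖] + [U]) + [U] ≤ 2[𝔖]` of the tree inequalities
`OutsiderSandwichYield.mk_matMul_le_mk_twistedStar_add_mk_matMul112` (`[M] ≤ [𝔖] + [U]`) and
`OutsiderSandwichDelayThree.two_mul_mk_matMul112_le_mk_twistedStar` (`2[U] ≤ [𝔖]`).

Under the rotation bridge `C₁ = rotate 𝔖` (`FarEdgeDescentCouplingBridge`) the `𝔖`-frame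
`⟨1,1,2⟩` is the `C₁`-frame inner product `⟨1,2,1⟩`, so together with
`OutsiderSandwichNoPadding.not_spare_inner` (`[M] + 2[⟨1,2,1⟩] ≰ 2[C₁]`) this is the exact
boundary of the spare ledger at level one: ONE inner spare yes, TWO no; the vector-leg
orientation (`⟨1,1,2⟩` in the `C₁`-frame) is the census's border-type valley I89b, not a
restriction claim of this file.

* `mk_matMul_add_mk_matMul112_le_two_mul_mk_twistedStar` — `[⟨2,2,2⟩] + [⟨1,1,2⟩] ≤ 2[𝔖₂(1)]` in
  `T(K)`, any field `K`;
* `unitTwo_twistedStar_restrictsTo_matMul_directSum_matMul112` — tensor form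
  `⟨2⟩ ⊠ 𝔖₂(1) ⊵ ⟨2,2,2⟩ ⊕ ⟨1,1,2⟩`.

## References
* M. Christandl, P. Vrana, J. Zuiddam, *Universal points in the asymptotic spectrum of tensors*,
  J. Amer. Math. Soc. 36 (2023), §1.1. [ChristandlVranaZuiddam2023]
* D. Coppersmith, S. Winograd, *Matrix multiplication via arithmetic progressions*,
  J. Symbolic Comput. 9 (1990) 251–280, §7. [CoppersmithWinograd1990]
-/

noncomputable section
open scoped BigOperators
set_option linter.dupNamespace false
set_option autoImplicit false

namespace Summit.MatrixMultiplication.MatrixMultiplication.Theorems.OutsiderSandwichOneSpare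

open Literature.Computability.AlgebraicComplexity
open Summit.MatrixMultiplication.MatrixMultiplication.Theorems.OutsiderSandwichDelayThree
open Summit.MatrixMultiplication.MatrixMultiplication.Theorems.OutsiderSandwichYield
open Summit.MatrixMultiplication.MatrixMultiplication.Theorems.FarEdgeDescentTwistedStar

variable {K : Type} [Field K]

/-- **One spare, in the semiring**: `[⟨2,2,2⟩] + [⟨1,1,2⟩] ≤ 2·[𝔖₂(1)]` in `T(K)`.
[cite: ChristandlVranaZuiddam2023, §1.1] -/
theorem mk_matMul_add_mk_matMul112_le_two_mul_mk_twistedStar :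
    TensorClass.mk (matMulTensor K 2 2 2) + TensorClass.mk (matMulTensor K 1 1 2) ≤
      (2 : TensorClass K) * TensorClass.mk (twistedStar K 2 1) := by
  set M := TensorClass.mk (matMulTensor K 2 2 2) with hM
  set S := TensorClass.mk (twistedStar K 2 1) with hS
  set U := TensorClass.mk (matMulTensor K 1 1 2) with hU
  calc M + U ≤ (S + U) + U :=
        TensorClass.add_le_add mk_matMul_le_mk_twistedStar_add_mk_matMul112 le_rfl
    _ = S + (2 : TensorClass K) * U := by ring
    _ ≤ S + S := TensorClass.add_le_add le_rfl two_mul_mk_matMul112_le_mk_twistedStar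
    _ = (2 : TensorClass K) * S := by ring

/-- **One spare** (tensor form): `⟨2⟩ ⊠ 𝔖₂(1) ⊵ ⟨2,2,2⟩ ⊕ ⟨1,1,2⟩` — two twisted stars give one
`2 × 2` product and one spare matrix–vector pair. [cite: CoppersmithWinograd1990, §7] -/
theorem unitTwo_twistedStar_restrictsTo_matMul_directSum_matMul112 :
    TensorRestrictsTo (kroneckerTensor (unitTensor K 2) (twistedStar K 2 1))
      (directSumTensor (matMulTensor K 2 2 2) (matMulTensor K 1 1 2)) := by
  rw [← TensorClass.mk_le_mk_iff, ← TensorClass.mk_add_mk, ← TensorClass.mk_mul_mk,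
    ← TensorClass.natCast_eq_mk, Nat.cast_ofNat]
  exact mk_matMul_add_mk_matMul112_le_two_mul_mk_twistedStar

end Summit.MatrixMultiplication.MatrixMultiplication.Theorems.OutsiderSandwichOneSpare
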